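import Literature.MeasureTheory.Group.InvariantQuotientCompactSubgroup       -- ★ `quotientMeasure_eq_inv_smul_map_mk` (compact subgroup: `μ_{G/Z} = ρ(Z)⁻¹ • π_*ν`)
import Literature.NumberTheory.Rogawski1990.ArchEllipticOrbitHSBall             -- ★ p848531: `hs_le_of_hs_conj_torusMatrix_le` (orbit ball ⊆ group ball, per place) — ED. 2
import Literature.NumberTheory.Automorphic.ArchSchwartzSpace                     -- ★ p848256: `archHSGL`, `archHSGL_endoEmbArch`; brings ★ `archAt`, `endoEmbArch` — ED. 2
import Mathlib.Analysis.SpecialFunctions.Pow.Real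
import HarnessLib

/-!
# The volume of Hilbert–Schmidt orbit balls at a COMPACT centraliser, from group-side growth and an orbit∕group comparison
# (the (VOL) assembler of line LH3, elliptic case; Beuzart-Plessis 2020 §1.5 (1.5.2)–(1.5.3))

Topic `NumberTheory/Rogawski1990`; namespace `Literature.NumberTheory.Rogawski1990`.  THEOREMS ONLY (no `def`, no instance, no notation, no axiom, no named fact,
no `sorry`).  Cell `pub/hodgecm-mathlib`, crux H413 (`stmt-HodgeConjecture-24833`), F0∕P3c line LH3, DEAL #10 (ASM-ell) of LH3-plan (g0) (2026-09-02T03:23:49Z;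
seat LH3-p04 (g0)): the ASSEMBLER that turns (i) LINEAR group-side growth of the Haar volume of HS-balls and (ii) an orbit∕group radius comparison
`Q(g) ≤ B · P(ḡ)^e` into the volume hypothesis `hvol` of ★ `ArchSchwartzOrbitalIntegralConvergence.integrable_descConj_of_archSchwartzGL_of_volumeGrowth` (p848470) for the
invariant quotient measure `μ_{G/Z} = dν ∕ dρ` at a class whose centraliser `Z` is COMPACT (every regular elliptic class of `H_∞ = U(Φ₂)(L⁺ ⊗ ℝ) × U(Φ₁)(L⁺ ⊗ ℝ)`).

§1 `quotientMeasure_ball_le_of_compact_of_comparison` — GROUP-AGNOSTIC: `G` locally compact second countable Hausdorff, `Z ≤ G` closed and compact with a Haar,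
inversion-invariant `ρ`, `ν` Haar on `G`; a measurable radius `P` on `G ⧸ Z` (`P ≥ 1`) and any radius `Q` on `G` with `Q(g) ≤ B P(ḡ)^e` (`B ≥ 1`, `e ≥ 0`); if `ν{Q ≤ r} ≤ A r (1 + log r)^m` for
`r ≥ 1` then `μ_{G/Z}{P ≤ R} ≤ A′ R^e (1 + log R)^m` for `R ≥ 1`, `A′ = ρ(Z)⁻¹ · max A 0 · B · (1 + log B + e)^m` — by ★ `quotientMeasure_eq_inv_smul_map_mk`
(`μ_{G/Z} = ρ(Z)⁻¹ • π_* ν` for compact `Z`) and `1 + log(B R^e) ≤ (1 + log B + e)(1 + log R)`.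
§2 (ROAD, docstring only — the H_∞ elliptic instance): `G = H_∞`, `Z = Z(γ)` (`CompactSpace` at a regular elliptic `γ`: ★ `ArchEndoscopicStableClassCompactH`),
`μ = mH c` through the (W_H) clause of ★ `ArchCompatibleFamiliesH` ∕ ★ `IsQuotientOf`, `P = descConj γ Z _ (archHSGL L 3 ∘ ι_∞)` (`≥ 1`, ★ `one_le_archHSGL_endoEmbArch`),
`Q = archHSGL L 3 ∘ ι_∞`, `e = 1∕2`; `hcmp` = ★ `ArchEllipticOrbitHSBall.hs_le_of_hs_conj_torusMatrix_le` (p848531) place by place (componentwise conjugation under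
★ `archPiEquivCM`, product ★ `archHSGL_endoEmbArch`) — item (ASM-ell-cmp); `hgrp` = LH3-p03's (T3) «places multiply» over LH3-p02's (T2-out) per-place linear growth
(★ `SL2HSBallVolume`, p848555∕p848577).
HONEST LABEL: HC_CM is proved only modulo the 7 printed citations (2 remaining: hLiu418 = stmt-HodgeConjecture-24832, h413 = stmt-HodgeConjecture-24833) until rung 0
closes; this file closes no organ — it is the junction brick of (VOL) (residual of (CONV), A3-hardening of the LETTERS O1∕O3 of `stub_N9`).

## References
* [BeuzartPlessis2020Asterisque] R. Beuzart-Plessis, *A local trace formula for the Gan–Gross–Prasad conjecture for unitary groups: the archimedean case*,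
  Astérisque 418 (2020), §1.5 (1.5.2)–(1.5.3) p. 31.
* [Folland1995] G. B. Folland, *A Course in Abstract Harmonic Analysis* (1995), §2.6 Thm. 2.49, (2.52) (quotient by a compact subgroup).
-/

set_option autoImplicit false

noncomputable section

open MeasureTheory Set
open Literature.MeasureTheory.Group
open scoped ENNReal

namespace Literature.NumberTheory.Rogawski1990

section Assembler

variable {G : Type*} [Group G] [TopologicalSpace G] [IsTopologicalGroup G] [LocallyCompactSpace G]
  [SecondCountableTopology G] [T2Space G] [MeasurableSpace G] [BorelSpace G]

/-- `1 + log (B R^e) ≤ (1 + log B + e)(1 + log R)` for `B, R ≥ 1`, `e ≥ 0`. [folklore] -/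
private theorem one_add_log_mul_rpow_le {B R e : ℝ} (hB : 1 ≤ B) (hR : 1 ≤ R) (he : 0 ≤ e) :
    1 + Real.log (B * R ^ e) ≤ (1 + Real.log B + e) * (1 + Real.log R) := by
  have hB0 : 0 < B := lt_of_lt_of_le one_pos hB
  have hR0 : 0 < R := lt_of_lt_of_le one_pos hR
  rw [Real.log_mul hB0.ne' (Real.rpow_pos_of_pos hR0 e).ne', Real.log_rpow hR0]
  have hlB : 0 ≤ Real.log B := Real.log_nonneg hB
  have hlR : 0 ≤ Real.log R := Real.log_nonneg hR
  nlinarith [mul_nonneg hlB hlR, mul_nonneg he hlR]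

/-- **THE (VOL) ASSEMBLER AT A COMPACT SUBGROUP.**  `Z ≤ G` closed and compact with Haar, inversion-invariant `ρ`; `ν` Haar on `G`; `P ≥ 1` a measurable radius on
`G ⧸ Z`, `Q` any radius on `G` with `Q(g) ≤ B · P(ḡ)^e` (`B ≥ 1`, `e ≥ 0`).  If the `ν`-volume of `{Q ≤ r}` grows at most like `A r (1 + log r)^m` (`r ≥ 1`), then the
`μ_{G/Z}`-volume of `{P ≤ R}` grows at most like `A′ R^e (1 + log R)^m` (`R ≥ 1`), for the invariant quotient measure `μ_{G/Z} = quotientMeasure Z ρ _ ν` — which for compact `Z`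
is `ρ(Z)⁻¹ • π_* ν` (★ `quotientMeasure_eq_inv_smul_map_mk`).  This is the shape of the hypothesis `hvol` of ★ `integrable_descConj_of_archSchwartzGL_of_volumeGrowth`.
[cite: BeuzartPlessis2020Asterisque, §1.5 (1.5.2)–(1.5.3) p. 31] [cite: Folland1995, §2.6 (2.52)] -/
theorem quotientMeasure_ball_le_of_compact_of_comparison
    (Z : Subgroup G) (hZ : IsClosed (Z : Set G)) [CompactSpace Z]
    (ρ : Measure Z) [ρ.IsHaarMeasure] [ρ.IsInvInvariant] (ν : Measure G) [ν.IsHaarMeasure] [ν.IsMulRightInvariant]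
    [MeasurableSpace (G ⧸ Z)] [BorelSpace (G ⧸ Z)]
    {P : G ⧸ Z → ℝ} (hP : Measurable P) (hP1 : ∀ x, 1 ≤ P x)
    {Q : G → ℝ}
    {e B : ℝ} (he : 0 ≤ e) (hB : 1 ≤ B)
    (hcmp : ∀ g : G, Q g ≤ B * P (QuotientGroup.mk g) ^ e)
    (hgrp : ∃ (A : ℝ) (m : ℕ), ∀ r : ℝ, 1 ≤ r → ν {g | Q g ≤ r} ≤ ENNReal.ofReal (A * r * (1 + Real.log r) ^ m)) :
    ∃ (A : ℝ) (m : ℕ), ∀ R : ℝ, 1 ≤ R →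
      quotientMeasure Z ρ hZ ν {x | P x ≤ R} ≤ ENNReal.ofReal (A * R ^ e * (1 + Real.log R) ^ m) := by
  haveI : IsClosed (Z : Set G) := hZ
  obtain ⟨A, m, hgrp⟩ := hgrp
  -- constants
  have hρ0 : ρ Set.univ ≠ 0 := (isOpen_univ.measure_pos ρ univ_nonempty).ne'
  have hρtop : ρ Set.univ ≠ ⊤ := (isCompact_univ.measure_lt_top (μ := ρ)).ne
  set c : ℝ := (ρ Set.univ).toReal⁻¹ with hc
  have hcpos : 0 < c := inv_pos.mpr (ENNReal.toReal_pos hρ0 hρtop)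
  have hcinv : (ρ Set.univ)⁻¹ = ENNReal.ofReal c := by
    rw [hc, ENNReal.ofReal_inv_of_pos (ENNReal.toReal_pos hρ0 hρtop), ENNReal.ofReal_toReal hρtop]
  set A' : ℝ := max A 0 with hA'
  have hA'0 : 0 ≤ A' := le_max_right _ _
  have hB0 : 0 < B := lt_of_lt_of_le one_pos hB
  have hlB : 0 ≤ Real.log B := Real.log_nonneg hB
  refine ⟨c * A' * B * (1 + Real.log B + e) ^ m, m, fun R hR => ?_⟩
  have hR0 : 0 < R := lt_of_lt_of_le one_pos hR
  have hRe : 1 ≤ R ^ e := Real.one_le_rpow hR he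
  have hRe0 : 0 ≤ R ^ e := Real.rpow_nonneg hR0.le e
  have hlR : 0 ≤ Real.log R := Real.log_nonneg hR
  have hr : 1 ≤ B * R ^ e := by nlinarith
  -- the quotient measure of the ball, read on the group
  have hS : MeasurableSet {x : G ⧸ Z | P x ≤ R} := measurableSet_le hP measurable_const
  rw [quotientMeasure_eq_inv_smul_map_mk Z ρ ν, Measure.smul_apply, Measure.map_apply QuotientGroup.continuous_mk.measurable hS, smul_eq_mul]
  -- orbit ball ⊆ group ball of radius `B R^e`
  have hsub : (QuotientGroup.mk : G → G ⧸ Z) ⁻¹' {x : G ⧸ Z | P x ≤ R} ⊆ {g : G | Q g ≤ B * R ^ e} := by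
    intro g hg
    have hPg : P (QuotientGroup.mk g) ≤ R := hg
    have hP0 : 0 ≤ P (QuotientGroup.mk g) := le_trans zero_le_one (hP1 _)
    calc Q g ≤ B * P (QuotientGroup.mk g) ^ e := hcmp g
      _ ≤ B * R ^ e := mul_le_mul_of_nonneg_left (Real.rpow_le_rpow hP0 hPg he) hB0.le
  -- group growth at radius `B R^e`, with `A ≤ A'` and the logarithm split
  have hgrowth : ν {g : G | Q g ≤ B * R ^ e} ≤ ENNReal.ofReal (A' * B * R ^ e * (1 + Real.log B + e) ^ m * (1 + Real.log R) ^ m) := by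
    refine (hgrp _ hr).trans (ENNReal.ofReal_le_ofReal ?_)
    have hlog0 : 0 ≤ 1 + Real.log (B * R ^ e) := by
      have : 0 ≤ Real.log (B * R ^ e) := Real.log_nonneg hr
      linarith
    have hlog : (1 + Real.log (B * R ^ e)) ^ m ≤ ((1 + Real.log B + e) * (1 + Real.log R)) ^ m :=
      pow_le_pow_left₀ hlog0 (one_add_log_mul_rpow_le hB hR he) m
    have hX0 : 0 ≤ B * R ^ e * (1 + Real.log (B * R ^ e)) ^ m := mul_nonneg (by positivity) (pow_nonneg hlog0 m)
    calc A * (B * R ^ e) * (1 + Real.log (B * R ^ e)) ^ m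
        = A * (B * R ^ e * (1 + Real.log (B * R ^ e)) ^ m) := by ring
      _ ≤ A' * (B * R ^ e * (1 + Real.log (B * R ^ e)) ^ m) := mul_le_mul_of_nonneg_right (le_max_left _ _) hX0
      _ ≤ A' * (B * R ^ e * ((1 + Real.log B + e) * (1 + Real.log R)) ^ m) :=
          mul_le_mul_of_nonneg_left (mul_le_mul_of_nonneg_left hlog (by positivity)) hA'0
      _ = A' * B * R ^ e * (1 + Real.log B + e) ^ m * (1 + Real.log R) ^ m := by rw [mul_pow]; ring
  calc (ρ Set.univ)⁻¹ * ν ((QuotientGroup.mk : G → G ⧸ Z) ⁻¹' {x : G ⧸ Z | P x ≤ R})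
      ≤ (ρ Set.univ)⁻¹ * ν {g : G | Q g ≤ B * R ^ e} := mul_le_mul' le_rfl (measure_mono hsub)
    _ ≤ ENNReal.ofReal c * ENNReal.ofReal (A' * B * R ^ e * (1 + Real.log B + e) ^ m * (1 + Real.log R) ^ m) := by
        rw [hcinv]; exact mul_le_mul' le_rfl hgrowth
    _ = ENNReal.ofReal (c * A' * B * (1 + Real.log B + e) ^ m * R ^ e * (1 + Real.log R) ^ m) := by
        rw [← ENNReal.ofReal_mul hcpos.le]
        congr 1
        ring

end Assembler

/-! ## §2 (ED. 2) The `H_∞` elliptic COMPARISON `hcmp` (ASM-ell-cmp): `archHSGL(ι_∞ h) ≤ B · archHSGL(ι_∞(h γ h⁻¹))^{1∕2}` for `γ` in the compact torus -/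

section EndoComparison

open NumberField NumberField.mixedEmbedding Literature.NumberTheory.Automorphic
open scoped MatrixGroups Matrix ComplexConjugate Classical

variable (L : Type) [Field L] [NumberField L] [IsCMField L]

/-- The `w`-component matrix of `k₂ ∈ U(Φ₂)(L ⊗ ℝ)` (through ★ `archAt`) is `Φ₂`-unitary over `ℂ` in the plain-matrix currency of ★ `ArchEllipticOrbitHSBall`.
[cite: Rogawski1990, §3.1 p. 19] -/
theorem archAt_two_unitary (w : {w : InfinitePlace L // w.IsComplex})
    (k : ↥(UnitaryGroup.arch (↥(maximalRealSubfield L)) L (IsCMField.complexConj L) 2 (Matrix.of fun i j : Fin 2 => if i.val + j.val + 1 = 2 then (1 : L) else 0))) :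
    ((((UnitaryGroup.archAt (↥(maximalRealSubfield L)) L (IsCMField.complexConj L) 2
          (Matrix.of fun i j : Fin 2 => if i.val + j.val + 1 = 2 then (1 : L) else 0) w
          (UnitaryGroup.complexConj_smul_infinitePlace L w.1) (IsCMField.complexConj_ne_one L) k :
            ↥(UnitaryGroup.archLocal L 2 (Matrix.of fun i j : Fin 2 => if i.val + j.val + 1 = 2 then (1 : L) else 0) w)) :
          GL (Fin 2) ℂ) : Matrix (Fin 2) (Fin 2) ℂ).map (starRingEnd ℂ))ᵀ *
        (Matrix.of fun i j : Fin 2 => if i.val + j.val + 1 = 2 then (1 : ℂ) else 0) *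
        (((UnitaryGroup.archAt (↥(maximalRealSubfield L)) L (IsCMField.complexConj L) 2
          (Matrix.of fun i j : Fin 2 => if i.val + j.val + 1 = 2 then (1 : L) else 0) w
          (UnitaryGroup.complexConj_smul_infinitePlace L w.1) (IsCMField.complexConj_ne_one L) k :
            ↥(UnitaryGroup.archLocal L 2 (Matrix.of fun i j : Fin 2 => if i.val + j.val + 1 = 2 then (1 : L) else 0) w)) :
          GL (Fin 2) ℂ) : Matrix (Fin 2) (Fin 2) ℂ) =
      (Matrix.of fun i j : Fin 2 => if i.val + j.val + 1 = 2 then (1 : ℂ) else 0) := by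
  have h := (UnitaryGroup.mem_archLocal_iff L 2 (Matrix.of fun i j : Fin 2 => if i.val + j.val + 1 = 2 then (1 : L) else 0) w _).1
    (UnitaryGroup.archAt (↥(maximalRealSubfield L)) L (IsCMField.complexConj L) 2
      (Matrix.of fun i j : Fin 2 => if i.val + j.val + 1 = 2 then (1 : L) else 0) w
      (UnitaryGroup.complexConj_smul_infinitePlace L w.1) (IsCMField.complexConj_ne_one L) k).2
  rwa [antidiagOne_map] at h

set_option maxHeartbeats 400000 in
/-- **(ASM-ell-cmp) — orbit∕group comparison for a torus point, all places**: if the `w`-component of `γ₂` is `torusMatrix (λ₁ w) (λ₂ w)` with `λ₁ w ≠ λ₂ w` at every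
complex place (a REGULAR point of the compact torus `T_c^{Hom(L,ℂ)∕c} ⊂ U(Φ₂)(L⁺ ⊗ ℝ)`; the `U(Φ₁)`-component is arbitrary), then for every `h ∈ H_∞`:
`archHSGL(ι_∞ h) ≤ B · archHSGL(ι_∞ (h γ h⁻¹))^{1∕2}` with `B = √(∏_w K_w)`, `K_w = (16 + 32|λ₂ w|²)∕|λ₁ w − λ₂ w|² + 2` — place by place ★ `hs_le_of_hs_conj_torusMatrix_le`
(p848531) squared to `(S_w + 1)² ≤ K_w (X_w + 1)`, multiplied over places through ★ `archHSGL_endoEmbArch`.  This is the hypothesis `hcmp` of §1 at `e = 1∕2` for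
`P = descConj γ Z _ (archHSGL ∘ ι_∞)`, `Q = archHSGL ∘ ι_∞`. [cite: BeuzartPlessis2020Asterisque, §1.5 (1.5.2)–(1.5.3) p. 31] [cite: Rogawski1990, §4.6 Prop. 4.6.1] -/
theorem exists_archHSGL_endoEmbArch_le_mul_rpow_half_conj
    (γ : (↥(UnitaryGroup.arch (↥(maximalRealSubfield L)) L (IsCMField.complexConj L) 2
          (Matrix.of fun i j : Fin 2 => if i.val + j.val + 1 = 2 then (1 : L) else 0)) ×
        ↥(UnitaryGroup.arch (↥(maximalRealSubfield L)) L (IsCMField.complexConj L) 1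
          (Matrix.of fun i j : Fin 1 => if i.val + j.val + 1 = 1 then (1 : L) else 0))))
    (l₁ l₂ : {w : InfinitePlace L // w.IsComplex} → ℂ) (hreg : ∀ w, l₁ w ≠ l₂ w)
    (hγ : ∀ w, (((UnitaryGroup.archAt (↥(maximalRealSubfield L)) L (IsCMField.complexConj L) 2
          (Matrix.of fun i j : Fin 2 => if i.val + j.val + 1 = 2 then (1 : L) else 0) w
          (UnitaryGroup.complexConj_smul_infinitePlace L w.1) (IsCMField.complexConj_ne_one L) γ.1 :
            ↥(UnitaryGroup.archLocal L 2 (Matrix.of fun i j : Fin 2 => if i.val + j.val + 1 = 2 then (1 : L) else 0) w)) :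
          GL (Fin 2) ℂ) : Matrix (Fin 2) (Fin 2) ℂ) = torusMatrix (l₁ w) (l₂ w)) :
    ∃ B : ℝ, 1 ≤ B ∧
      ∀ h : (↥(UnitaryGroup.arch (↥(maximalRealSubfield L)) L (IsCMField.complexConj L) 2
          (Matrix.of fun i j : Fin 2 => if i.val + j.val + 1 = 2 then (1 : L) else 0)) ×
        ↥(UnitaryGroup.arch (↥(maximalRealSubfield L)) L (IsCMField.complexConj L) 1
          (Matrix.of fun i j : Fin 1 => if i.val + j.val + 1 = 1 then (1 : L) else 0))),
        archHSGL L 3 ((endoEmbArch L h).val : GL (Fin 3) (mixedSpace L)) ≤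
          B * archHSGL L 3 ((endoEmbArch L (h * γ * h⁻¹)).val : GL (Fin 3) (mixedSpace L)) ^ (1 / 2 : ℝ) := by
  -- per-place constants
  set K : {w : InfinitePlace L // w.IsComplex} → ℝ := fun w => (16 + 32 * ‖l₂ w‖ ^ 2) / ‖l₁ w - l₂ w‖ ^ 2 + 2 with hK
  have hKpos : ∀ w, 1 ≤ K w := fun w => by
    have : 0 ≤ (16 + 32 * ‖l₂ w‖ ^ 2) / ‖l₁ w - l₂ w‖ ^ 2 := by positivity
    simp only [hK]; linarith
  have hK1 : 1 ≤ ∏ w, K w := by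
    calc (1 : ℝ) = ∏ _w : {w : InfinitePlace L // w.IsComplex}, (1 : ℝ) := Finset.prod_const_one.symm
      _ ≤ ∏ w, K w := Finset.prod_le_prod (fun _ _ => zero_le_one) fun w _ => hKpos w
  refine ⟨Real.sqrt (∏ w, K w), Real.one_le_sqrt.mpr hK1, fun h => ?_⟩
  -- abbreviations: the place components
  set A := fun (k : ↥(UnitaryGroup.arch (↥(maximalRealSubfield L)) L (IsCMField.complexConj L) 2
      (Matrix.of fun i j : Fin 2 => if i.val + j.val + 1 = 2 then (1 : L) else 0))) (w : {w : InfinitePlace L // w.IsComplex}) =>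
    (((UnitaryGroup.archAt (↥(maximalRealSubfield L)) L (IsCMField.complexConj L) 2
          (Matrix.of fun i j : Fin 2 => if i.val + j.val + 1 = 2 then (1 : L) else 0) w
          (UnitaryGroup.complexConj_smul_infinitePlace L w.1) (IsCMField.complexConj_ne_one L) k :
            ↥(UnitaryGroup.archLocal L 2 (Matrix.of fun i j : Fin 2 => if i.val + j.val + 1 = 2 then (1 : L) else 0) w)) :
          GL (Fin 2) ℂ) : Matrix (Fin 2) (Fin 2) ℂ) with hA
  -- HS at a place, read through `archAt` (definitional: ★ `coe_archAt_apply`)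
  have hHS : ∀ (k : ↥(UnitaryGroup.arch (↥(maximalRealSubfield L)) L (IsCMField.complexConj L) 2
      (Matrix.of fun i j : Fin 2 => if i.val + j.val + 1 = 2 then (1 : L) else 0))) (w : {w : InfinitePlace L // w.IsComplex}),
      (∑ i : Fin 2, ∑ j : Fin 2, ‖(((k : GL (Fin 2) (mixedSpace L)) : Matrix (Fin 2) (Fin 2) (mixedSpace L)) i j).2 w‖ ^ 2) =
        ∑ i : Fin 2, ∑ j : Fin 2, ‖A k w i j‖ ^ 2 := fun k w => rfl
  -- the place component of `h₂ γ₂ h₂⁻¹` is `A h w * torusMatrix * (A h w)⁻¹`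
  have hconj : ∀ w, A (h * γ * h⁻¹).1 w = A h.1 w * torusMatrix (l₁ w) (l₂ w) * (A h.1 w)⁻¹ := by
    intro w
    simp only [hA, Prod.fst_mul, Prod.fst_inv, map_mul, map_inv, Subgroup.coe_mul, Subgroup.coe_inv, Units.val_mul, Matrix.coe_units_inv]
    rw [← hγ w]
  -- per place: `(S_w + 1)² ≤ K_w (X_w + 1)`
  have hplace : ∀ w : {w : InfinitePlace L // w.IsComplex},
      (∑ i : Fin 2, ∑ j : Fin 2, ‖A h.1 w i j‖ ^ 2 + 1) ^ 2 ≤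
        K w * (∑ i : Fin 2, ∑ j : Fin 2, ‖A (h * γ * h⁻¹).1 w i j‖ ^ 2 + 1) := by
    intro w
    set S : ℝ := ∑ i : Fin 2, ∑ j : Fin 2, ‖A h.1 w i j‖ ^ 2 with hS
    set X : ℝ := ∑ i : Fin 2, ∑ j : Fin 2, ‖A (h * γ * h⁻¹).1 w i j‖ ^ 2 with hX
    have hS0 : 0 ≤ S := Finset.sum_nonneg fun i _ => Finset.sum_nonneg fun j _ => by positivity
    have hX0 : 0 ≤ X := Finset.sum_nonneg fun i _ => Finset.sum_nonneg fun j _ => by positivity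
    have hδ : 0 < ‖l₁ w - l₂ w‖ := norm_pos_iff.mpr (sub_ne_zero.mpr (hreg w))
    have hXeq : ∑ i : Fin 2, ∑ j : Fin 2, ‖(A h.1 w * torusMatrix (l₁ w) (l₂ w) * (A h.1 w)⁻¹) i j‖ ^ 2 ≤ X := by
      rw [hX, hconj w]
    have hSle : S ≤ 2 * Real.sqrt (2 * X + 4 * ‖l₂ w‖ ^ 2) / ‖l₁ w - l₂ w‖ :=
      hs_le_of_hs_conj_torusMatrix_le (archAt_two_unitary L w h.1) (hreg w) hXeq
    have hT0 : 0 ≤ 2 * X + 4 * ‖l₂ w‖ ^ 2 := by positivity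
    have hsq : S ^ 2 ≤ 4 * (2 * X + 4 * ‖l₂ w‖ ^ 2) / ‖l₁ w - l₂ w‖ ^ 2 := by
      have h1 : S ^ 2 ≤ (2 * Real.sqrt (2 * X + 4 * ‖l₂ w‖ ^ 2) / ‖l₁ w - l₂ w‖) ^ 2 := pow_le_pow_left₀ hS0 hSle 2
      rw [div_pow, mul_pow, Real.sq_sqrt hT0] at h1
      calc S ^ 2 ≤ 2 ^ 2 * (2 * X + 4 * ‖l₂ w‖ ^ 2) / ‖l₁ w - l₂ w‖ ^ 2 := h1
        _ = 4 * (2 * X + 4 * ‖l₂ w‖ ^ 2) / ‖l₁ w - l₂ w‖ ^ 2 := by norm_num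
    have hδ2 : 0 < ‖l₁ w - l₂ w‖ ^ 2 := pow_pos hδ 2
    simp only [hK]
    rw [div_add' _ _ _ hδ2.ne', div_mul_eq_mul_div, le_div_iff₀ hδ2]
    rw [le_div_iff₀ hδ2] at hsq
    nlinarith [hsq, hS0, hX0, sq_nonneg (‖l₂ w‖), mul_nonneg hX0 (sq_nonneg ‖l₂ w‖), mul_nonneg hX0 hδ2.le,
      mul_nonneg (sq_nonneg (S - 1)) hδ2.le, hδ2.le]
  -- multiply over places
  have hprodS : archHSGL L 3 ((endoEmbArch L h).val : GL (Fin 3) (mixedSpace L)) =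
      ∏ w, (∑ i : Fin 2, ∑ j : Fin 2, ‖A h.1 w i j‖ ^ 2 + 1) := by
    rw [archHSGL_endoEmbArch]
    exact Finset.prod_congr rfl fun w _ => by rw [hHS]
  have hprodX : archHSGL L 3 ((endoEmbArch L (h * γ * h⁻¹)).val : GL (Fin 3) (mixedSpace L)) =
      ∏ w, (∑ i : Fin 2, ∑ j : Fin 2, ‖A (h * γ * h⁻¹).1 w i j‖ ^ 2 + 1) := by
    rw [archHSGL_endoEmbArch]
    exact Finset.prod_congr rfl fun w _ => by rw [hHS]
  have hP0 : ∀ w : {w : InfinitePlace L // w.IsComplex}, 0 ≤ ∑ i : Fin 2, ∑ j : Fin 2, ‖A h.1 w i j‖ ^ 2 + 1 := fun w =>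
    add_nonneg (Finset.sum_nonneg fun i _ => Finset.sum_nonneg fun j _ => by positivity) zero_le_one
  have hQ0 : ∀ w : {w : InfinitePlace L // w.IsComplex}, 0 ≤ ∑ i : Fin 2, ∑ j : Fin 2, ‖A (h * γ * h⁻¹).1 w i j‖ ^ 2 + 1 := fun w =>
    add_nonneg (Finset.sum_nonneg fun i _ => Finset.sum_nonneg fun j _ => by positivity) zero_le_one
  have hsq : (∏ w, (∑ i : Fin 2, ∑ j : Fin 2, ‖A h.1 w i j‖ ^ 2 + 1)) ^ 2 ≤
      (∏ w, K w) * ∏ w, (∑ i : Fin 2, ∑ j : Fin 2, ‖A (h * γ * h⁻¹).1 w i j‖ ^ 2 + 1) := by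
    rw [← Finset.prod_pow, ← Finset.prod_mul_distrib]
    exact Finset.prod_le_prod (fun w _ => pow_nonneg (hP0 w) 2) fun w _ => hplace w
  rw [hprodS, hprodX]
  have hlhs0 : 0 ≤ ∏ w, (∑ i : Fin 2, ∑ j : Fin 2, ‖A h.1 w i j‖ ^ 2 + 1) := Finset.prod_nonneg fun w _ => hP0 w
  have hrhs0 : 0 ≤ ∏ w, (∑ i : Fin 2, ∑ j : Fin 2, ‖A (h * γ * h⁻¹).1 w i j‖ ^ 2 + 1) := Finset.prod_nonneg fun w _ => hQ0 w
  rw [← Real.sqrt_eq_rpow, ← Real.sqrt_mul (le_trans zero_le_one hK1)]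
  exact (Real.le_sqrt hlhs0 (mul_nonneg (le_trans zero_le_one hK1) hrhs0)).mpr hsq

end EndoComparison

end Literature.NumberTheory.Rogawski1990

end
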